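import Summits.Ventures.Crystal3D.Theorems.StickyWulffConstantNoReconstructionGainLowCoordRim
import Summits.Ventures.Crystal3D.Theorems.StickyWulffConstantNoReconstructionGainLowCoordAdhesion
import HarnessLib

/-!
# Slab geometry for the grain rung of the `(111)` adhesion atom

HONEST FRAMING. Part of the venture `Summits/Ventures/Crystal3D` (cell `crystal3d-full`), helper
`--supports` the crux `NoReconstructionGain` (stmt-Ventures-19144, route
`route-Ventures-StickyWulffConstant`), line `adhesion`, GRAIN RUNG (the atom at `ν = e₃` for
overlayers contained in one rigid-motion image of a Barlow stacking).  Geometry of the slab sample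
`P` at `ν = e₃`, `R = 4` (all sites of `fccStacking 1 √(2/3)` with `−8 ≤ z ≤ −4` and lateral
radius `≤ ρ`, i.e. the five hexagonal layers `k = −9, …, −5`, `h = √(2/3)`), slab potential
`Φ(y) = max (y₂ + 5h, −9h − y₂, 0)`:

* `le_slabPotential_of_lateral` — the FORBIDDEN REGION: a non-sample ball of the packing with
  lateral radius `≤ ρ − 1` has `Φ ≥ h` (it is neither inside the slab nor within height `h` of a
  face: covering radius `1/√3` of each layer, `…LayerCover`).  This is the geometric half of
  `rim_of_lowPotential_partner` (`…LowCoordGeom`), isolated.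
* `card_rim_three_le` — the sites of lateral radius `> ρ − 3` number `≤ 85 π ρ` (`ρ ≥ 4`).
* toucher facts for a ball `q ∉ P` touching a CORE site `p` (lateral radius `≤ ρ − 3`):
  `Φ q ≥ h` and the height dichotomy (`toucher_dichotomy`: `q` lies in the band
  `[−4h, −5h + 1]` above or `[−9h − 1, −10h]` below), at most three sample partners
  (`card_samplePartners_le_three`), and the SLOT EXCLUSION `not_mem_of_slot_above/below`: a point
  `y` at distance `≤ 1` from an above-toucher `q` with `y₂ ≤ q₂ − 19/100` (resp. `≥ q₂ + 19/100`
  for a below-toucher) is not a ball of `X \ P` — it falls in the forbidden region.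

WHAT THIS IS NOT: the rung itself; nothing about grains yet; rung F-C1 not moved.
-/

noncomputable section

namespace Summit.Ventures.Crystal3D.Theorems

open Summit.Ventures.Crystal3D Finset Real
open Literature.MathematicalPhysics.StatisticalMechanics (barlowPos barlowStacking fccStacking
  constHagg isHaggSeq_const haggLabel_const barlowPos_mem barlowPos_apply_zero barlowPos_apply_one
  barlowPos_apply_two le_dist_barlowPos_of_ideal)
open scoped InnerProductSpace

/-! ## Numerical facts -/

/-- `h = √(2/3) > 81/100` (so the toucher band `1 − h` is thinner than `19/100`). -/
theorem sqrt_two_thirds_gt : (81 : ℝ) / 100 < Real.sqrt (2 / 3) := by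
  have h0 : 0 ≤ Real.sqrt (2 / 3) := Real.sqrt_nonneg _
  have h2 : Real.sqrt (2 / 3) ^ 2 = 2 / 3 := Real.sq_sqrt (by norm_num)
  nlinarith [h2, h0]

/-- Squared distance in coordinates. -/
theorem dist_sq_eq_three (y q : EuclideanSpace ℝ (Fin 3)) :
    dist y q ^ 2 = (y 0 - q 0) ^ 2 + (y 1 - q 1) ^ 2 + (y 2 - q 2) ^ 2 := by
  rw [EuclideanSpace.dist_eq, Real.sq_sqrt (Finset.sum_nonneg fun _ _ => sq_nonneg _),
    Fin.sum_univ_three]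
  simp only [Real.dist_eq, sq_abs]

/-- Lateral radius grows by at most the distance: `dist y q ≤ 1`, `|q̄| ≤ r` give `|ȳ| ≤ r + 1`. -/
theorem lateral_sq_le_of_dist_le_one {y q : EuclideanSpace ℝ (Fin 3)} {r : ℝ} (hr : 0 ≤ r)
    (hq : q 0 ^ 2 + q 1 ^ 2 ≤ r ^ 2) (hd : dist y q ≤ 1) :
    y 0 ^ 2 + y 1 ^ 2 ≤ (r + 1) ^ 2 := by
  have hd2 : (y 0 - q 0) ^ 2 + (y 1 - q 1) ^ 2 ≤ 1 ^ 2 := by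
    have h1 : dist y q ^ 2 ≤ 1 ^ 2 := pow_le_pow_left₀ dist_nonneg hd 2
    rw [dist_sq_eq_three] at h1
    nlinarith [sq_nonneg (y 2 - q 2)]
  have := planar_sq_add_sq_le (q 0) (q 1) (y 0 - q 0) (y 1 - q 1) r 1 hr zero_le_one hq hd2
  have e0 : q 0 + (y 0 - q 0) = y 0 := by ring
  have e1 : q 1 + (y 1 - q 1) = y 1 := by ring
  rw [e0, e1] at this
  exact this

/-! ## The forbidden region -/

/-- **Forbidden region.**  `P` = the slab sample (`ρ ≥ 4`) inside a unit packing `X`,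
`Φ(y) = max (y₂ + 5h, −9h − y₂, 0)`.  A ball `q ∈ X \ P` of lateral radius `≤ ρ − 1` has
`Φ q ≥ h`: over the disc of radius `ρ − 1` there is no room inside the slab, and the lowest
positions over the top layer (highest under the bottom layer) are the hollow sites at height `h`. -/
theorem le_slabPotential_of_lateral (ρ : ℝ) (hρ : 4 ≤ ρ) (X P : Finset (EuclideanSpace ℝ (Fin 3)))
    (hX : ∀ p ∈ X, ∀ q ∈ X, p ≠ q → 1 ≤ dist p q) (hPX : P ⊆ X)
    (hP : ∀ p, p ∈ P ↔ (p ∈ fccStacking 1 (Real.sqrt (2 / 3)) ∧ -8 ≤ p 2 ∧ p 2 ≤ -4 ∧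
      p 0 ^ 2 + p 1 ^ 2 ≤ ρ ^ 2))
    (Φ : EuclideanSpace ℝ (Fin 3) → ℝ)
    (hΦ : ∀ y, Φ y = max (y 2 + 5 * Real.sqrt (2 / 3)) (max (-(9 * Real.sqrt (2 / 3)) - y 2) 0))
    (q : EuclideanSpace ℝ (Fin 3)) (hqX : q ∈ X) (hqP : q ∉ P)
    (hlatq : q 0 ^ 2 + q 1 ^ 2 ≤ (ρ - 1) ^ 2) :
    Real.sqrt (2 / 3) ≤ Φ q := by
  obtain ⟨hh2, hh45, hh89⟩ := sqrt_two_thirds_bounds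
  set h : ℝ := Real.sqrt (2 / 3) with hhdef
  have hhpos : 0 < h := by linarith
  -- a covering site of layer `k` within lateral `ρ`, at height in `[-8,-4]`, is a sample ball
  have hsite : ∀ k i j : ℤ, -9 ≤ k → k ≤ -5 →
      (q 0 - barlowPos 1 h constHagg k i j 0) ^ 2 + (q 1 - barlowPos 1 h constHagg k i j 1) ^ 2
        ≤ 1 / 3 → barlowPos 1 h constHagg k i j ∈ P := by
    intro k i j hk1 hk2 hcov
    rw [hP]
    refine ⟨barlowPos_mem _ _ _, ?_, ?_, ?_⟩
    · rw [barlowPos_apply_two]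
      have : (-9 : ℝ) ≤ k := by exact_mod_cast hk1
      nlinarith
    · rw [barlowPos_apply_two]
      have : (k : ℝ) ≤ -5 := by exact_mod_cast hk2
      nlinarith
    · have := planar_sq_add_sq_le (q 0) (q 1) (barlowPos 1 h constHagg k i j 0 - q 0)
        (barlowPos 1 h constHagg k i j 1 - q 1) (ρ - 1) 1 (by linarith) zero_le_one hlatq (by
          have e : (barlowPos 1 h constHagg k i j 0 - q 0) ^ 2 +
              (barlowPos 1 h constHagg k i j 1 - q 1) ^ 2 =
              (q 0 - barlowPos 1 h constHagg k i j 0) ^ 2 +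
                (q 1 - barlowPos 1 h constHagg k i j 1) ^ 2 := by ring
          rw [e]; linarith)
      have e0 : q 0 + (barlowPos 1 h constHagg k i j 0 - q 0) = barlowPos 1 h constHagg k i j 0 := by
        ring
      have e1 : q 1 + (barlowPos 1 h constHagg k i j 1 - q 1) = barlowPos 1 h constHagg k i j 1 := by
        ring
      rw [e0, e1, show ρ - 1 + 1 = ρ by ring] at this
      exact this
  -- distance from `q` to a covering site, squared
  have hdist : ∀ k i j : ℤ, dist q (barlowPos 1 h constHagg k i j) ^ 2 =
      (q 0 - barlowPos 1 h constHagg k i j 0) ^ 2 + (q 1 - barlowPos 1 h constHagg k i j 1) ^ 2 +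
      (q 2 - (k : ℝ) * h) ^ 2 := by
    intro k i j
    rw [dist_sq_eq_three, barlowPos_apply_two]
  -- a sample ball is at distance `≥ 1` from `q`
  have hfar : ∀ p' ∈ P, 1 ≤ dist q p' := fun p' hp' =>
    hX q hqX p' (hPX hp') fun hqp => hqP (hqp ▸ hp')
  by_cases hup : -(5 * h) < q 2
  · -- above the top layer `k = -5`: hollow position, `Φ q ≥ h`
    obtain ⟨i, j, hcov⟩ := exists_fccSite_planar_sq_le_third (q 0) (q 1) (-5)
    have hmem := hsite (-5) i j (by norm_num) (by norm_num) hcov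
    have hsq := hollow_height_sq q (-5) i j hcov (hfar _ hmem)
    push_cast at hsq
    have hpos : 0 < q 2 + 5 * h := by linarith
    have hge : h ≤ q 2 + 5 * h := by
      by_contra hlt
      have hlt := not_le.1 hlt
      nlinarith [hh2]
    exact le_trans hge (by rw [hΦ]; exact le_max_left _ _)
  by_cases hdown : q 2 < -(9 * h)
  · -- below the bottom layer `k = -9`
    obtain ⟨i, j, hcov⟩ := exists_fccSite_planar_sq_le_third (q 0) (q 1) (-9)
    have hmem := hsite (-9) i j (by norm_num) (by norm_num) hcov
    have hsq := hollow_height_sq q (-9) i j hcov (hfar _ hmem)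
    push_cast at hsq
    have hpos : 0 < -(9 * h) - q 2 := by linarith
    have hge : h ≤ -(9 * h) - q 2 := by
      by_contra hlt
      have hlt := not_le.1 hlt
      nlinarith [hh2]
    exact le_trans hge (by rw [hΦ]; exact le_trans (le_max_left _ _) (le_max_right _ _))
  · -- inside the slab: the nearest layer is within `h/2`, its covering site within distance `< 1`
    exfalso
    have hup' := not_lt.1 hup
    have hdown' := not_lt.1 hdown
    set k : ℤ := ⌊q 2 / h + 1 / 2⌋ with hk
    have hk1 : (k : ℝ) ≤ q 2 / h + 1 / 2 := Int.floor_le _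
    have hk2 : q 2 / h + 1 / 2 < (k : ℝ) + 1 := Int.lt_floor_add_one _
    have hqh : q 2 / h * h = q 2 := div_mul_cancel₀ _ hhpos.ne'
    have hkh : |q 2 - (k : ℝ) * h| ≤ h / 2 := by
      rw [abs_le]; constructor
      · have := mul_le_mul_of_nonneg_right hk1 hhpos.le
        rw [add_mul, hqh] at this; linarith
      · have := mul_le_mul_of_nonneg_right hk2.le hhpos.le
        rw [add_mul, add_mul, hqh] at this; linarith
    have hklo : -9 ≤ k := by
      have h1 : (-9 : ℝ) ≤ q 2 / h := by rw [le_div_iff₀ hhpos]; linarith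
      have h2 : (-9 : ℤ) ≤ ⌊q 2 / h + 1 / 2⌋ := Int.le_floor.2 (by push_cast; linarith)
      rw [hk]; exact h2
    have hkhi : k ≤ -5 := by
      have h1 : q 2 / h ≤ -5 := by rw [div_le_iff₀ hhpos]; linarith
      have h2 : ⌊q 2 / h + 1 / 2⌋ < (-5 : ℤ) + 1 := Int.floor_lt.2 (by push_cast; linarith)
      rw [hk]; omega
    obtain ⟨i, j, hcov⟩ := exists_fccSite_planar_sq_le_third (q 0) (q 1) k
    have hmem := hsite k i j hklo hkhi hcov
    have h1 := hfar _ hmem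
    have hd2 := hdist k i j
    have hzk : (q 2 - (k : ℝ) * h) ^ 2 ≤ (h / 2) ^ 2 := by
      rw [← sq_abs]; exact pow_le_pow_left₀ (abs_nonneg _) hkh 2
    have hlt1 : dist q (barlowPos 1 h constHagg k i j) ^ 2 < 1 := by
      have e : (h / 2) ^ 2 = 1 / 6 := by rw [div_pow, hh2]; norm_num
      rw [hd2]; linarith [hzk.trans_eq e]
    have hge1 : 1 ≤ dist q (barlowPos 1 h constHagg k i j) ^ 2 := by
      have h0 : 0 ≤ dist q (barlowPos 1 h constHagg k i j) := dist_nonneg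
      nlinarith
    linarith

/-! ## Touchers of core sites -/

/-- **A ball touching a core site has `Φ ≥ h`.**  If `q ∈ X \ P` touches a site `p ∈ P` of
lateral radius `≤ ρ − 3`, then `Φ q ≥ h` (contrapositive of `rim_of_lowPotential_partner`). -/
theorem le_slabPotential_of_touch_core (ρ : ℝ) (hρ : 4 ≤ ρ)
    (X P : Finset (EuclideanSpace ℝ (Fin 3)))
    (hX : ∀ p ∈ X, ∀ q ∈ X, p ≠ q → 1 ≤ dist p q) (hPX : P ⊆ X)
    (hP : ∀ p, p ∈ P ↔ (p ∈ fccStacking 1 (Real.sqrt (2 / 3)) ∧ -8 ≤ p 2 ∧ p 2 ≤ -4 ∧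
      p 0 ^ 2 + p 1 ^ 2 ≤ ρ ^ 2))
    (Φ : EuclideanSpace ℝ (Fin 3) → ℝ)
    (hΦ : ∀ y, Φ y = max (y 2 + 5 * Real.sqrt (2 / 3)) (max (-(9 * Real.sqrt (2 / 3)) - y 2) 0))
    (p q : EuclideanSpace ℝ (Fin 3)) (hqX : q ∈ X) (hqP : q ∉ P)
    (hcore : p 0 ^ 2 + p 1 ^ 2 ≤ (ρ - 3) ^ 2) (hpq : dist p q = 1) :
    Real.sqrt (2 / 3) ≤ Φ q := by
  by_contra hlt
  have hrim := rim_of_lowPotential_partner ρ hρ X P hX hPX hP Φ hΦ p q hqX hqP hpq (not_le.1 hlt)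
  nlinarith

/-- **Height dichotomy for touchers.**  With `h = √(2/3)`: if `q` has `Φ q ≥ h` and touches a
sample site `p` (`−9h ≤ p₂ ≤ −5h`), then either `q` lies in the band `−4h ≤ q₂ ≤ −5h + 1` above
the top face, or in the band `−9h − 1 ≤ q₂ ≤ −10h` below the bottom face. -/
theorem toucher_dichotomy (Φ : EuclideanSpace ℝ (Fin 3) → ℝ)
    (hΦ : ∀ y, Φ y = max (y 2 + 5 * Real.sqrt (2 / 3)) (max (-(9 * Real.sqrt (2 / 3)) - y 2) 0))
    (p q : EuclideanSpace ℝ (Fin 3))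
    (hp1 : -(9 * Real.sqrt (2 / 3)) ≤ p 2) (hp2 : p 2 ≤ -(5 * Real.sqrt (2 / 3)))
    (hpq : dist p q = 1) (hΦq : Real.sqrt (2 / 3) ≤ Φ q) :
    (-(4 * Real.sqrt (2 / 3)) ≤ q 2 ∧ q 2 ≤ -(5 * Real.sqrt (2 / 3)) + 1) ∨
      (-(9 * Real.sqrt (2 / 3)) - 1 ≤ q 2 ∧ q 2 ≤ -(10 * Real.sqrt (2 / 3))) := by
  obtain ⟨hh2, hh45, hh89⟩ := sqrt_two_thirds_bounds
  set h : ℝ := Real.sqrt (2 / 3) with hhdef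
  have hdz : (q 2 - p 2) ^ 2 ≤ 1 := by
    have hd := dist_sq_eq_three q p
    rw [dist_comm, hpq] at hd
    nlinarith [sq_nonneg (q 0 - p 0), sq_nonneg (q 1 - p 1)]
  have hz1 : q 2 ≤ p 2 + 1 := by nlinarith [sq_nonneg (q 2 - p 2 - 1)]
  have hz2 : p 2 - 1 ≤ q 2 := by nlinarith [sq_nonneg (q 2 - p 2 + 1)]
  rw [hΦ] at hΦq
  rcases le_max_iff.1 hΦq with h1 | h1
  · left; exact ⟨by linarith, by linarith⟩
  · rcases le_max_iff.1 h1 with h2 | h2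
    · right; exact ⟨by linarith, by linarith⟩
    · exfalso; linarith

/-- **At most three sample partners.**  A ball `q` with `Φ q ≥ h` touches at most three sites of
the sample `P` (they are steep partners: `Φ = 0` on `P`; cone lemma
`card_steepPartners_le_three`). -/
theorem card_samplePartners_le_three (X P : Finset (EuclideanSpace ℝ (Fin 3)))
    (hX : ∀ p ∈ X, ∀ q ∈ X, p ≠ q → 1 ≤ dist p q) (hPX : P ⊆ X)
    (Φ : EuclideanSpace ℝ (Fin 3) → ℝ)
    (hΦ : ∀ y, Φ y = max (y 2 + 5 * Real.sqrt (2 / 3)) (max (-(9 * Real.sqrt (2 / 3)) - y 2) 0))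
    (hΦP : ∀ p ∈ P, Φ p = 0)
    (q : EuclideanSpace ℝ (Fin 3)) (hΦq : Real.sqrt (2 / 3) ≤ Φ q) :
    (P.filter fun p => dist q p = 1).card ≤ 3 := by
  classical
  refine le_trans (card_le_card ?_) (card_steepPartners_le_three X hX q Φ hΦ)
  intro p hp
  rw [mem_filter] at hp ⊢
  refine ⟨hPX hp.1, hp.2, ?_⟩
  rw [hΦP p hp.1]; linarith

/-- **Slot exclusion above.**  `q ∈ X \ P` an above-toucher of a core site (`Φ`-band
`−4h ≤ q₂ ≤ −5h + 1`, lateral radius `≤ ρ − 2`); then no ball of `X \ P` sits at a point `y`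
with `dist y q ≤ 1` and `y₂ ≤ q₂ − 19/100`: such a `y` has lateral radius `≤ ρ − 1` and
`Φ y < h`, contradicting the forbidden region. -/
theorem not_mem_sdiff_of_slot_above (ρ : ℝ) (hρ : 4 ≤ ρ)
    (X P : Finset (EuclideanSpace ℝ (Fin 3)))
    (hX : ∀ p ∈ X, ∀ q ∈ X, p ≠ q → 1 ≤ dist p q) (hPX : P ⊆ X)
    (hP : ∀ p, p ∈ P ↔ (p ∈ fccStacking 1 (Real.sqrt (2 / 3)) ∧ -8 ≤ p 2 ∧ p 2 ≤ -4 ∧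
      p 0 ^ 2 + p 1 ^ 2 ≤ ρ ^ 2))
    (q y : EuclideanSpace ℝ (Fin 3))
    (hq1 : -(4 * Real.sqrt (2 / 3)) ≤ q 2) (hq2 : q 2 ≤ -(5 * Real.sqrt (2 / 3)) + 1)
    (hlatq : q 0 ^ 2 + q 1 ^ 2 ≤ (ρ - 2) ^ 2)
    (hdy : dist y q ≤ 1) (hy : y 2 ≤ q 2 - 19 / 100) : y ∉ X \ P := by
  classical
  intro hyQ
  obtain ⟨hh2, hh45, hh89⟩ := sqrt_two_thirds_bounds
  have hgt := sqrt_two_thirds_gt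
  set h : ℝ := Real.sqrt (2 / 3) with hhdef
  set Φ : EuclideanSpace ℝ (Fin 3) → ℝ := fun w => max (w 2 + 5 * h) (max (-(9 * h) - w 2) 0)
    with hΦdef
  have hΦ : ∀ w, Φ w = max (w 2 + 5 * h) (max (-(9 * h) - w 2) 0) := fun w => rfl
  have hlat : y 0 ^ 2 + y 1 ^ 2 ≤ (ρ - 2 + 1) ^ 2 :=
    lateral_sq_le_of_dist_le_one (by linarith) hlatq hdy
  rw [show ρ - 2 + 1 = ρ - 1 by ring] at hlat
  have hge := le_slabPotential_of_lateral ρ hρ X P hX hPX hP Φ hΦ y (mem_sdiff.1 hyQ).1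
    (mem_sdiff.1 hyQ).2 hlat
  -- but `Φ y < h`
  have hdz : q 2 - 1 ≤ y 2 := by
    have h1 : dist y q ^ 2 ≤ 1 ^ 2 := pow_le_pow_left₀ dist_nonneg hdy 2
    rw [dist_sq_eq_three] at h1
    nlinarith [sq_nonneg (y 0 - q 0), sq_nonneg (y 1 - q 1), sq_nonneg (y 2 - q 2 + 1)]
  have hlt : Φ y < h := by
    rw [hΦ]
    refine max_lt (by linarith) (max_lt (by linarith) (by linarith))
  linarith

/-- **Slot exclusion below.**  Mirror statement for a below-toucher (`−9h − 1 ≤ q₂ ≤ −10h`):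
no ball of `X \ P` at `y` with `dist y q ≤ 1` and `y₂ ≥ q₂ + 19/100`. -/
theorem not_mem_sdiff_of_slot_below (ρ : ℝ) (hρ : 4 ≤ ρ)
    (X P : Finset (EuclideanSpace ℝ (Fin 3)))
    (hX : ∀ p ∈ X, ∀ q ∈ X, p ≠ q → 1 ≤ dist p q) (hPX : P ⊆ X)
    (hP : ∀ p, p ∈ P ↔ (p ∈ fccStacking 1 (Real.sqrt (2 / 3)) ∧ -8 ≤ p 2 ∧ p 2 ≤ -4 ∧
      p 0 ^ 2 + p 1 ^ 2 ≤ ρ ^ 2))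
    (q y : EuclideanSpace ℝ (Fin 3))
    (hq1 : -(9 * Real.sqrt (2 / 3)) - 1 ≤ q 2) (hq2 : q 2 ≤ -(10 * Real.sqrt (2 / 3)))
    (hlatq : q 0 ^ 2 + q 1 ^ 2 ≤ (ρ - 2) ^ 2)
    (hdy : dist y q ≤ 1) (hy : q 2 + 19 / 100 ≤ y 2) : y ∉ X \ P := by
  classical
  intro hyQ
  obtain ⟨hh2, hh45, hh89⟩ := sqrt_two_thirds_bounds
  have hgt := sqrt_two_thirds_gt
  set h : ℝ := Real.sqrt (2 / 3) with hhdef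
  set Φ : EuclideanSpace ℝ (Fin 3) → ℝ := fun w => max (w 2 + 5 * h) (max (-(9 * h) - w 2) 0)
    with hΦdef
  have hΦ : ∀ w, Φ w = max (w 2 + 5 * h) (max (-(9 * h) - w 2) 0) := fun w => rfl
  have hlat : y 0 ^ 2 + y 1 ^ 2 ≤ (ρ - 2 + 1) ^ 2 :=
    lateral_sq_le_of_dist_le_one (by linarith) hlatq hdy
  rw [show ρ - 2 + 1 = ρ - 1 by ring] at hlat
  have hge := le_slabPotential_of_lateral ρ hρ X P hX hPX hP Φ hΦ y (mem_sdiff.1 hyQ).1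
    (mem_sdiff.1 hyQ).2 hlat
  have hdz : y 2 ≤ q 2 + 1 := by
    have h1 : dist y q ^ 2 ≤ 1 ^ 2 := pow_le_pow_left₀ dist_nonneg hdy 2
    rw [dist_sq_eq_three] at h1
    nlinarith [sq_nonneg (y 0 - q 0), sq_nonneg (y 1 - q 1), sq_nonneg (y 2 - q 2 - 1)]
  have hlt : Φ y < h := by
    rw [hΦ]
    refine max_lt (by linarith) (max_lt (by linarith) (by linarith))
  linarith

end Summit.Ventures.Crystal3D.Theorems

end
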